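import Literature.NumberTheory.NumberFields.RingClassFieldOfConductor
import Literature.NumberTheory.GaloisRepresentations.HeckeCharacterOfRayClass
import Literature.NumberTheory.EllipticCurves.HeegnerPoints
import HarnessLib

/-!
# Conductor descent for ring class characters: a character of `I_K(m)/P_{K,ℤ}(m)` whose Hecke
# character is unramified at the unique prime `λ ∣ ℓ`, `ℓ ∥ m`, dies on the classes of conductor `m/ℓ`

Cell `b2b-bsdres`, team x11b3 (N8/O2), lead ruling R8-42 (A) = sub-target (b2) "conductor descent" of
the `htot` programme (x11b3-p8's `KolyvaginRingClassInertia`, hypothesis `htot`: the factors of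
`λ = (ℓ)` are totally ramified in `K[m]/K[m/ℓ]`, Gross 1991 p. 218 l. 1 / McCallum 1991 p. 282 l. 1).
HONEST FRAMING (cell, verbatim): published theorems only; nothing booked; class-field-theory hygiene
for the Kolyvagin chain, nothing `p = 3`-specific, JET@p∣N untouched, `h44` NOT discharged here;
O2 OPEN / N8 CONSTRUCTION.  Theorems only — no definition, no named fact.

Setting: `K` an imaginary quadratic field, `m ≠ 0`, `ℓ` a prime with `ℓ ∣ m`, `ℓ ∤ m/ℓ`, and `v₀`
the UNIQUE prime of `K` above `ℓ` (inert or ramified).  For a character `χ` of the ring class group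
`I_K(m)/P_{K,ℤ}(m)` (the tree's `RingClass.RingClassGroup K m`, Cox §7.C) the values
`ψ(𝔭) = χ([𝔭])` on primes form a ray class character `mod m𝓞_K`
(`RingClassField.isRayClassCharacter_primeClass`), whose Hecke character is the tree's
`ω = heckeOfRayClass` (Cassels–Fröhlich VII Prop. 4.1 / Neukirch VI (1.9)).

* `rayIdeleValue_principalIdele_eq_one_of_isUnramifiedAt` — **the idelic glue**: if `ω` is
  unramified at a prime `v₀ ∣ 𝔣` then the ideal character `ω₀ = ∏_{𝔭 ∤ 𝔣} ψ(𝔭)^{ord_𝔭}` kills every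
  principal idele `(k)` with `k` a `v₀`-unit and `k ≡ 1 mod 𝔭^{n_𝔭}` at the OTHER primes of `𝔣`
  (no congruence at `v₀`): `ω₀((k)) = ω((k)·⟨k⁻¹⟩_{v₀}) = ω(⟨k⁻¹⟩_{v₀}) = 1`.
* `ringClassChar_eq_one_of_heckeUnramified` (E1) — consequently, for `ψ = χ([·]_m)` with `ω`
  unramified at `v₀`: `χ([𝔭_v]_m) = 1` for every `v ∤ m` whose class of conductor `m/ℓ` is trivial
  (`[𝔭_v]_{m/ℓ} = 1`, i.e. `𝔭_v = (α)`, `α ≡ n (mod m/ℓ)`, `n ∈ ℤ`): rescale by an integer `d` with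
  `d n ≡ 1 (mod m/ℓ)`, `d ≡ 1 (mod ℓ)` and apply the glue to `k = d α`.  This is the statement
  "`χ` factors through `I_K(m/ℓ)/P_{K,ℤ}(m/ℓ)`" in the Frobenius form the consumer
  (x11b3-p8's duality/Bauer step) uses; no map `RingClassGroup K m → RingClassGroup K (m/ℓ)` is
  introduced.

The class-field-level form (E2) `ringClassChar_factors_of_isUnramifiedAt` is the sequel file
`RingClassConductorDescent.lean` (Artin reciprocity in primitive form + rigidity of Hecke characters).

## References
* [Cox2013] D. A. Cox, *Primes of the form x² + ny²*, 2nd ed. (2013), §7.C Prop. 7.22, §9.A.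
* [NeukirchANT1999] J. Neukirch, *Algebraic Number Theory* (1999), Ch. VI §1 (1.7)–(1.9), §6 (6.6);
  Ch. VII §6 (6.13)–(6.14).
* [CasselsFrohlichANT1967] J. Tate, *Global class field theory*, VII §4 Prop. 4.1; [GrossLMS1991] §3 p. 218 l. 1.
## Mathlib / tree search
Tree: `heckeOfRayClass(_apply)`, `heckeOfRayClassFun_eq`, `rayIdeleValue_mul`, `rayIdeleValue_localUnits_of_valued_eq_one`,
`coe_finprod_rayUnitValue_pow_count`, `ideleOrd_principalIdele_eq_count_sub_count`, `valuation_coe_eq_exp_neg_count`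
(`GaloisRepresentations/HeckeCharacterOfRayClass`); `RingClassField.primeClass`, `idealClass_span_eq_one`,
`artinSymbol_primeClass_eq_idealClass`, `RingClass.exists_eq_mul_inv_of_mem_ringClassDen`; `AbelianDensity.idealPow_comp_eq`.
`lean search 'conductor descent|ringClassChar'`: nothing prior; lit2's `exists_generator_of_primeClass_eq_one`
(`RingClassFieldClassNumber`) is private and re-derived here (credited).
-/

noncomputable section

open scoped Classical nonZeroDivisors
open NumberField IsDedekindDomain IsDedekindDomain.HeightOneSpectrum
open Literature.NumberTheory.GaloisRepresentations Literature.NumberTheory.LFunctions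
open Literature.NumberTheory.LFunctions.AbelianDensity
open Literature.NumberTheory.NumberFields Literature.NumberTheory.NumberFields.RingClassField
open Literature.NumberTheory.QuadraticFields.RingClass
open Literature.NumberTheory.EllipticCurves (IsImaginaryQuadratic)

namespace Summit.BirchSwinnertonDyer.Rank1Residual.X11b.RingClassTower

variable {K : Type} [Field K] [NumberField K]

/-! ## §1. The idelic glue: `ω` unramified at `v₀ ∣ 𝔣` kills principal ideles `≡ 1` off `v₀` -/

/-- **Conductor lowering at one prime, idelic form.**  Let `ψ` be a ray class character `mod 𝔣` and
`ω = heckeOfRayClass` its Hecke character.  If `ω` is unramified at a prime `v₀` (trivial on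
`𝒪_{v₀}ˣ`), then `ω₀((k)) = ∏_{𝔭 ∤ 𝔣} ψ(𝔭)^{ord_𝔭 k} = 1` for every `k ∈ Kˣ` which is a `v₀`-unit,
satisfies `|k - 1|_v ≤ q_v^{-n_v}` at every OTHER prime `𝔭_v^{n_v} ∥ 𝔣`, and is positive at the real
places: indeed `(k)·⟨k⁻¹⟩_{v₀} ∈ W_𝔣`, so `1 = ω(⟨k⁻¹⟩_{v₀}) = ω((k)⟨k⁻¹⟩_{v₀}) = ω₀((k))·ω₀(⟨k⁻¹⟩_{v₀})
= ω₀((k))` (Neukirch VI (1.9): `C_K/C_K^𝔪 ≅ Cl^𝔪`; VI (6.6)).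
[cite: NeukirchANT1999, Ch. VI §1 Prop. (1.9) and §6 Cor. (6.6)] -/
theorem rayIdeleValue_principalIdele_eq_one_of_isUnramifiedAt {𝔣 : Ideal (𝓞 K)} (h𝔣 : 𝔣 ≠ ⊥)
    {ψ : HeightOneSpectrum (𝓞 K) → ℂ} (hψ : IsRayClassCharacter 𝔣 ψ)
    {v₀ : HeightOneSpectrum (𝓞 K)} (hunr : (heckeOfRayClass h𝔣 hψ).IsUnramifiedAt v₀)
    {k : Kˣ} (hk₀ : v₀.valuation K (k : K) = 1)
    (hk : ∀ v : HeightOneSpectrum (𝓞 K), modulusExp 𝔣 v ≠ 0 → v ≠ v₀ →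
      v.valuation K ((k : K) - 1) ≤ WithZero.exp (-(modulusExp 𝔣 v : ℤ)))
    (hpos : ∀ (w : InfinitePlace K) (hw : w.IsReal),
      0 < InfinitePlace.Completion.extensionEmbeddingOfIsReal hw
        ((principalIdele K k : AdeleRing (𝓞 K) K).1 w)) :
    rayIdeleValue hψ (principalIdele K k) = 1 := by
  -- the local unit `u = k⁻¹ ∈ 𝒪_{v₀}ˣ`
  set a : v₀.adicCompletion K := algebraMap K (v₀.adicCompletion K) (k : K) with ha
  have ha1 : Valued.v a = 1 := by rw [ha, valued_algebraMap_adicCompletion]; exact hk₀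
  have ha0 : a ≠ 0 := fun h => by rw [h, map_zero] at ha1; exact zero_ne_one ha1
  have hainv1 : Valued.v a⁻¹ = 1 := by rw [map_inv₀, ha1, inv_one]
  set x₀ : v₀.adicCompletionIntegers K := ⟨a⁻¹, by
    rw [HeightOneSpectrum.mem_adicCompletionIntegers, hainv1]⟩ with hx₀
  have hx₀u : IsUnit x₀ :=
    HeightOneSpectrum.adicCompletionIntegers.isUnit_iff_valued_eq_one.2 (by exact hainv1)
  set u₀ : (v₀.adicCompletionIntegers K)ˣ := hx₀u.unit with hu₀
  set U : (v₀.adicCompletion K)ˣ := Units.map ((v₀.adicCompletionIntegers K).subtype : _ →* _) u₀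
    with hU
  have hUval : (U : v₀.adicCompletion K) = a⁻¹ := by
    rw [hU, Units.coe_map]; rfl
  have hUv : Valued.v (U : v₀.adicCompletion K) = 1 := by rw [hUval, hainv1]
  -- `ω(⟨u⟩) = 1`
  have hω1 : heckeOfRayClass h𝔣 hψ (localUnits v₀ U) = 1 := by
    have := hunr u₀
    rwa [HeckeCharacter.localComponent_apply] at this
  -- `(k)·⟨u⟩ ∈ W_𝔣`
  have hmem : principalIdele K k * localUnits v₀ U ∈ congruenceIdeles 𝔣 := by
    refine ⟨fun v hv => ?_, fun w hw => ?_⟩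
    · rw [ideleGroup_val_snd_mul, principalIdele_snd]
      by_cases hvv : v = v₀
      · subst hvv
        rw [localUnits_snd_apply_self, hUval, ← ha, mul_inv_cancel₀ ha0, sub_self, map_zero]
        exact zero_le
      · rw [localUnits_snd_apply_of_ne U hvv, mul_one, ← map_one (algebraMap K (v.adicCompletion K)),
          ← map_sub, valued_algebraMap_adicCompletion]
        exact hk v hv hvv
    · have e : ((principalIdele K k * localUnits v₀ U : ideleGroup K) : AdeleRing (𝓞 K) K).1 w =
          ((principalIdele K k : ideleGroup K) : AdeleRing (𝓞 K) K).1 w * 1 := rfl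
      rw [e, mul_one]
      exact hpos w hw
  -- `ω(⟨u⟩) = ω₀((k)⟨u⟩) = ω₀((k)) ω₀(⟨u⟩) = ω₀((k))`
  have hcalc : heckeOfRayClass h𝔣 hψ (localUnits v₀ U) =
      rayIdeleValue hψ (principalIdele K k) * rayIdeleValue hψ (localUnits v₀ U) := by
    rw [heckeOfRayClass_apply, heckeOfRayClassFun_eq h𝔣 hψ hmem, rayIdeleValue_mul]
  rw [hω1, rayIdeleValue_localUnits_of_valued_eq_one hψ v₀ hUv, mul_one] at hcalc
  exact hcalc.symm

/-- **The ideal character on an integral principal idele**: for a nonzero integer `b` prime to `𝔣`,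
`ω₀((b)) = χ((b))` (`LFunctions.idealPow`), i.e. `∏_{𝔭 ∤ 𝔣} ψ(𝔭)^{ord_𝔭 b} = ∏_𝔭 ψ(𝔭)^{ν_𝔭((b))}`
(Neukirch VII (6.14): `χ̃(𝔞)` on integral ideals prime to `𝔪`). [cite: NeukirchANT1999, Ch. VII §6 Cor. (6.14)] -/
theorem coe_rayIdeleValue_principalIdele_eq_idealPow {𝔣 : Ideal (𝓞 K)} (h𝔣 : 𝔣 ≠ ⊥)
    {ψ : HeightOneSpectrum (𝓞 K) → ℂ} (hψ : IsRayClassCharacter 𝔣 ψ)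
    {b : 𝓞 K} (hb : b ≠ 0) (hcop : IsCoprime (Ideal.span {b}) 𝔣) :
    ((rayIdeleValue hψ (principalIdele K (Units.mk0 (b : K)
        (RingOfIntegers.coe_ne_zero_iff.mpr hb))) : ℂˣ) : ℂ) = idealPow K ψ (Ideal.span {b}) := by
  set k : Kˣ := Units.mk0 (b : K) (RingOfIntegers.coe_ne_zero_iff.mpr hb) with hk
  have hbd : (b : K) = ((1 : 𝓞 K) : K) * k := by rw [hk, Units.val_mk0]; simp
  have hcount := ideleOrd_principalIdele_eq_count_sub_count (K := K) hb one_ne_zero hbd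
  have h1 : ∀ v : HeightOneSpectrum (𝓞 K),
      (Associates.mk v.asIdeal).count (Associates.mk (Ideal.span {(1 : 𝓞 K)} : Ideal (𝓞 K))).factors = 0 := by
    intro v
    rw [Ideal.span_singleton_one, ← Ideal.one_eq_top, Associates.mk_one, Associates.factors_one,
      Associates.count_zero ((Associates.irreducible_mk).mpr v.irreducible)]
  have e : rayIdeleValue hψ (principalIdele K k) =
      ∏ᶠ v : HeightOneSpectrum (𝓞 K), rayUnitValue hψ v ^
        ((Associates.mk v.asIdeal).count (Associates.mk (Ideal.span {b} : Ideal (𝓞 K))).factors : ℤ) := by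
    unfold rayIdeleValue
    exact finprod_congr fun v => by rw [hcount v, h1 v, Nat.cast_zero, sub_zero]
  rw [e]
  exact coe_finprod_rayUnitValue_pow_count h𝔣 hψ hb hcop

/-! ## §2. Ring class groups: a prime of trivial class of conductor `f` -/

/-- `[𝔭_v] = 1` in `I_K(f)/P_{K,ℤ}(f)` for `v ∤ f` means `𝔭_v = (a)` with `a ≡ n (mod f𝓞_K)` for an
integer `n` prime to `f` (Cox Prop. 7.22: `P_{K,ℤ}(f)` is generated by the `α𝓞_K`, `α ≡ a ∈ ℤ`
prime to `f`; `𝔭_v = (α)(β)⁻¹` with `α ≡ a`, `β ≡ b`; `a' = α/β` generates `𝔭_v` and `a' ≡ a b'`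
with `b b' ≡ 1`).  The computation of the tree's `RingClassField.exists_ringClassField_data_principal`
(and of lit2's private `exists_generator_of_primeClass_eq_one` in `RingClassFieldClassNumber`), extracted.
[cite: Cox2013, §7.C Prop. 7.22 and §9.A Thm. 9.2] -/
theorem exists_generator_of_primeClass_eq_one {f : ℕ} {v : HeightOneSpectrum (𝓞 K)}
    (hv : ¬ Ideal.span {(f : 𝓞 K)} ≤ v.asIdeal) (h1 : primeClass f v = 1) :
    ∃ (a : 𝓞 K) (n : ℤ), IsCoprime n (f : ℤ) ∧ v.asIdeal = Ideal.span {a} ∧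
      a - (n : 𝓞 K) ∈ Ideal.span {(f : 𝓞 K)} := by
  have hcop : v.asIdeal ⊔ Ideal.span {(f : 𝓞 K)} = ⊤ := (sup_span_eq_top_iff_not_le f).mpr hv
  rw [primeClass_of_sup_eq_top f hcop, idealClass_eq, QuotientGroup.eq_one_iff,
    Subgroup.mem_subgroupOf] at h1
  obtain ⟨g, hg, h, hh, hgh⟩ := exists_eq_mul_inv_of_mem_ringClassDen h1
  obtain ⟨α, a, ha, hαa, hgα⟩ := hg
  obtain ⟨β, b, hb, hβb, hhβ⟩ := hh
  have hβ0 : β ≠ 0 := by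
    rintro rfl
    have : ((h : (FractionalIdeal (𝓞 K)⁰ K)ˣ) : FractionalIdeal (𝓞 K)⁰ K) = 0 := by
      rw [hhβ]; simp
    exact Units.ne_zero h this
  have hvfrac : ((v.asIdeal : FractionalIdeal (𝓞 K)⁰ K)) * FractionalIdeal.spanSingleton (𝓞 K)⁰ (β : K) =
      FractionalIdeal.spanSingleton (𝓞 K)⁰ (α : K) := by
    have hval := congrArg (fun u : (FractionalIdeal (𝓞 K)⁰ K)ˣ => (u : FractionalIdeal (𝓞 K)⁰ K)) hgh
    simp only [Units.val_mul, Units.val_inv_eq_inv_val, FractionalIdeal.coe_mk0] at hval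
    rw [hgα, hhβ] at hval
    have hβK : (β : K) ≠ 0 := NumberField.RingOfIntegers.coe_ne_zero_iff.mpr hβ0
    rw [eq_mul_inv_iff_mul_eq₀ (by
      rw [Ne, FractionalIdeal.spanSingleton_eq_zero_iff]; exact hβK)] at hval
    exact hval
  have hβK : (β : K) ≠ 0 := NumberField.RingOfIntegers.coe_ne_zero_iff.mpr hβ0
  have hspan : (v.asIdeal : FractionalIdeal (𝓞 K)⁰ K) =
      FractionalIdeal.spanSingleton (𝓞 K)⁰ ((α : K) / (β : K)) := by
    rw [div_eq_mul_inv, ← FractionalIdeal.spanSingleton_mul_spanSingleton, ← hvfrac, mul_assoc,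
      FractionalIdeal.spanSingleton_mul_spanSingleton, mul_inv_cancel₀ hβK,
      FractionalIdeal.spanSingleton_one, mul_one]
  have hmem : (α : K) / (β : K) ∈ (v.asIdeal : FractionalIdeal (𝓞 K)⁰ K) := by
    rw [hspan]; exact FractionalIdeal.mem_spanSingleton_self _ _
  rw [FractionalIdeal.mem_coeIdeal] at hmem
  obtain ⟨a', -, ha'⟩ := hmem
  refine ⟨a', ?_⟩
  have hva' : v.asIdeal = Ideal.span {a'} := by
    apply FractionalIdeal.coeIdeal_injective (K := K)
    show (v.asIdeal : FractionalIdeal (𝓞 K)⁰ K) = ((Ideal.span {a'} : Ideal (𝓞 K)) : FractionalIdeal (𝓞 K)⁰ K)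
    rw [hspan, FractionalIdeal.coeIdeal_span_singleton, ha']
  have hab : a' * β = α := by
    apply NumberField.RingOfIntegers.coe_injective
    rw [map_mul, ha', div_mul_cancel₀ _ hβK]
  obtain ⟨b', k, hbk⟩ := hb
  refine ⟨a * b', ?_, hva', ?_⟩
  · have hb'cop : IsCoprime b' (f : ℤ) := ⟨b, k, by linear_combination hbk⟩
    exact IsCoprime.mul_left ha hb'cop
  · have h1 : a' - ((a * b' : ℤ) : 𝓞 K) =
        a' * ((k * (f : ℤ) : ℤ) : 𝓞 K) + (b' : 𝓞 K) * (α - (a : 𝓞 K)) -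
          a' * (b' : 𝓞 K) * (β - (b : 𝓞 K)) := by
      have hk : ((k * (f : ℤ) : ℤ) : 𝓞 K) = 1 - (b' : 𝓞 K) * (b : 𝓞 K) := by
        have := congrArg (fun z : ℤ => (z : 𝓞 K)) hbk
        push_cast at this ⊢
        linear_combination this
      rw [hk, ← hab]
      push_cast
      ring
    rw [h1]
    refine Submodule.sub_mem _ (Submodule.add_mem _ ?_ (Ideal.mul_mem_left _ _ hαa))
      (Ideal.mul_mem_left _ _ hβb)
    have : ((k * (f : ℤ) : ℤ) : 𝓞 K) = (k : 𝓞 K) * (f : 𝓞 K) := by push_cast; ring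
    rw [this]
    exact Ideal.mul_mem_left _ _ (Ideal.mul_mem_left _ _ (Ideal.mem_span_singleton_self _))

/-! ## §3. (E1) Conductor descent for ring class characters, Hecke form -/

/-- **(E1) Conductor descent, Hecke form.**  Let `K` be imaginary quadratic, `m ≠ 0`, `ℓ` a prime
with `ℓ ∣ m`, `ℓ ∤ m/ℓ`, `v₀` the UNIQUE prime of `K` above `ℓ`, and `χ` a character of the ring
class group `I_K(m)/P_{K,ℤ}(m)` whose Hecke character `ω = heckeOfRayClass` (of the ray class
character `𝔭 ↦ χ([𝔭]_m) mod m𝓞_K`) is unramified at `v₀`.  Then `χ([𝔭_v]_m) = 1` for every prime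
`v ∤ m` of trivial class of conductor `m/ℓ` (`[𝔭_v]_{m/ℓ} = 1`) — i.e. `χ` factors through
`I_K(m/ℓ)/P_{K,ℤ}(m/ℓ)`, in Frobenius form.  Proof: `𝔭_v = (α)` with `α ≡ n (mod m/ℓ)`, `n ∈ ℤ` prime
to `m/ℓ` (`exists_generator_of_primeClass_eq_one`); with an integer `d ≡ n⁻¹ (mod m/ℓ)`,
`d ≡ 1 (mod ℓ)` the element `k = d α` is a `v₀`-unit with `k ≡ 1 (mod m/ℓ)`, so
`1 = ω₀((k)) = χ([(d)]_m) χ([𝔭_v]_m) = χ([𝔭_v]_m)` (`rayIdeleValue_principalIdele_eq_one_of_isUnramifiedAt`,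
Cox (7.21)–Prop. 7.22: `(d) ∈ P_{K,ℤ}(m)`).  This is the conductor–ramification statement
Neukirch VI (6.6) for the ring class characters. [cite: NeukirchANT1999, Ch. VI §6 Cor. (6.6)]
[cite: Cox2013, §7.C Prop. 7.22 and §9.A] -/
theorem ringClassChar_eq_one_of_heckeUnramified (hK : IsImaginaryQuadratic K)
    {m ℓ : ℕ} (hm : m ≠ 0) (hℓ : ℓ.Prime) (hℓm : ℓ ∣ m) (hℓm' : ¬ ℓ ∣ m / ℓ)
    {v₀ : HeightOneSpectrum (𝓞 K)}
    (hv₀ : ∀ v : HeightOneSpectrum (𝓞 K), ((ℓ : ℕ) : 𝓞 K) ∈ v.asIdeal ↔ v = v₀)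
    (χ : RingClassGroup K m →* ℂˣ) (h𝔣 : Ideal.span {((m : ℕ) : 𝓞 K)} ≠ ⊥)
    (hψ : IsRayClassCharacter (Ideal.span {((m : ℕ) : 𝓞 K)}) (fun v => (χ (primeClass m v) : ℂ)))
    (hunr : (heckeOfRayClass h𝔣 hψ).IsUnramifiedAt v₀)
    {v : HeightOneSpectrum (𝓞 K)} (hv : ((m : ℕ) : 𝓞 K) ∉ v.asIdeal) (h1 : primeClass (m / ℓ) v = 1) :
    χ (primeClass m v) = 1 := by
  -- notation: `m = ℓ m'`
  set m' : ℕ := m / ℓ with hm'def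
  have hmm' : m = ℓ * m' := (Nat.mul_div_cancel' hℓm).symm
  have hm'0 : m' ≠ 0 := fun h => hm (by rw [hmm', h, mul_zero])
  have hcast : ((m : ℕ) : 𝓞 K) = ((ℓ : ℕ) : 𝓞 K) * ((m' : ℕ) : 𝓞 K) := by rw [hmm', Nat.cast_mul]
  have hℓv₀ : ((ℓ : ℕ) : 𝓞 K) ∈ v₀.asIdeal := (hv₀ v₀).mpr rfl
  have hcopℓ : Nat.Coprime ℓ m' := (Nat.Prime.coprime_iff_not_dvd hℓ).mpr hℓm'
  -- `v ∤ m'` and `v ≠ v₀`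
  have hvm' : ((m' : ℕ) : 𝓞 K) ∉ v.asIdeal := fun h => hv (hcast ▸ Ideal.mul_mem_left _ _ h)
  have hv' : ¬ Ideal.span {((m' : ℕ) : 𝓞 K)} ≤ v.asIdeal := by
    rwa [Ideal.span_singleton_le_iff_mem]
  have hvv₀ : v ≠ v₀ := by
    rintro rfl
    exact hv (hcast ▸ Ideal.mul_mem_right _ _ hℓv₀)
  -- `𝔭_v = (α)`, `α ≡ n (mod m')`, `n` prime to `m'`
  obtain ⟨α, n, hn, hvα, hαn⟩ := exists_generator_of_primeClass_eq_one hv' h1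
  have hα0 : α ≠ 0 := by
    intro h
    apply v.ne_bot
    rw [hvα, h, Ideal.span_singleton_eq_bot]
  have hαv₀ : α ∉ v₀.asIdeal := by
    intro h
    have hle : v.asIdeal ≤ v₀.asIdeal := by
      rw [hvα]; exact (Ideal.span_singleton_le_iff_mem _).mpr h
    exact hvv₀ (HeightOneSpectrum.ext (v.isMaximal.eq_of_le v₀.isPrime.ne_top hle))
  -- the integer `d ≡ n⁻¹ (mod m')`, `d ≡ 1 (mod ℓ)`
  obtain ⟨c, e, hce⟩ := hn
  obtain ⟨s, t, hst⟩ := Nat.isCoprime_iff_coprime.mpr hcopℓ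
  set d : ℤ := t * (m' : ℤ) + c * s * (ℓ : ℤ) with hd
  have hdn : d * n - 1 = (m' : ℤ) * (t * n - s * (ℓ : ℤ) * e - t) := by
    rw [hd]; linear_combination (s * (ℓ : ℤ)) * hce + hst
  have hd1 : d - 1 = (ℓ : ℤ) * (s * (c - 1)) := by
    rw [hd]; linear_combination hst
  have hdm : IsCoprime d (m : ℤ) := by
    have h1 : IsCoprime d (m' : ℤ) := ⟨n, -(t * n - s * (ℓ : ℤ) * e - t), by linear_combination hdn⟩
    have h2 : IsCoprime d (ℓ : ℤ) := ⟨1, -(s * (c - 1)), by linear_combination hd1⟩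
    rw [hmm', Nat.cast_mul]
    exact IsCoprime.mul_right h2 h1
  have hd0 : d ≠ 0 := by
    intro h0
    have h2 : IsCoprime d (ℓ : ℤ) := ⟨1, -(s * (c - 1)), by linear_combination hd1⟩
    rw [h0] at h2
    have := (isCoprime_zero_left.mp h2)
    rw [Int.isUnit_iff_natAbs_eq, Int.natAbs_natCast] at this
    exact hℓ.one_lt.ne' this
  have hdK0 : ((d : ℤ) : 𝓞 K) ≠ 0 := by exact_mod_cast hd0
  have hdv₀ : ((d : ℤ) : 𝓞 K) ∉ v₀.asIdeal := by
    intro h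
    have e1 : ((d : ℤ) : 𝓞 K) = 1 + ((ℓ : ℕ) : 𝓞 K) * (((s * (c - 1) : ℤ)) : 𝓞 K) := by
      have := congrArg (fun z : ℤ => (z : 𝓞 K)) hd1
      push_cast at this ⊢
      linear_combination this
    have h1 : (1 : 𝓞 K) ∈ v₀.asIdeal := by
      have := v₀.asIdeal.sub_mem h (Ideal.mul_mem_right ((((s * (c - 1) : ℤ)) : 𝓞 K)) _ hℓv₀)
      rwa [e1, add_sub_cancel_right] at this
    exact v₀.isPrime.ne_top ((Ideal.eq_top_iff_one _).mpr h1)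
  -- the element `k = d α`
  set k₀ : 𝓞 K := ((d : ℤ) : 𝓞 K) * α with hk₀
  have hk₀0 : k₀ ≠ 0 := mul_ne_zero hdK0 hα0
  have hk₀v₀ : k₀ ∉ v₀.asIdeal := fun h =>
    (v₀.isPrime.mem_or_mem h).elim hdv₀ hαv₀
  have hk₀1 : k₀ - 1 ∈ Ideal.span {((m' : ℕ) : 𝓞 K)} := by
    have e1 : k₀ - 1 = ((d : ℤ) : 𝓞 K) * (α - (n : 𝓞 K)) + (((d * n - 1 : ℤ)) : 𝓞 K) := by
      rw [hk₀]; push_cast; ring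
    rw [e1]
    refine Ideal.add_mem _ (Ideal.mul_mem_left _ _ hαn) ?_
    rw [hdn]
    push_cast
    exact Ideal.mul_mem_right _ _ (Ideal.mem_span_singleton_self _)
  -- the primes of `𝔣 = (m)` other than `v₀` contain `m'`, hence not `k₀`
  have hprime𝔣 : ∀ w : HeightOneSpectrum (𝓞 K), Ideal.span {((m : ℕ) : 𝓞 K)} ≤ w.asIdeal → w ≠ v₀ →
      ((m' : ℕ) : 𝓞 K) ∈ w.asIdeal ∧ k₀ ∉ w.asIdeal := by
    intro w hw hwv₀
    rw [Ideal.span_singleton_le_iff_mem, hcast] at hw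
    have hℓw : ((ℓ : ℕ) : 𝓞 K) ∉ w.asIdeal := fun h => hwv₀ ((hv₀ w).mp h)
    have hm'w : ((m' : ℕ) : 𝓞 K) ∈ w.asIdeal := (w.isPrime.mem_or_mem hw).resolve_left hℓw
    refine ⟨hm'w, fun hk => ?_⟩
    have h1 : k₀ - 1 ∈ w.asIdeal := (Ideal.span_singleton_le_iff_mem _).mpr hm'w hk₀1
    have : (1 : 𝓞 K) ∈ w.asIdeal := by simpa using w.asIdeal.sub_mem hk h1
    exact w.isPrime.ne_top ((Ideal.eq_top_iff_one _).mpr this)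
  have hcop : IsCoprime (Ideal.span {k₀}) (Ideal.span {((m : ℕ) : 𝓞 K)}) := by
    refine (isCoprime_iff_forall_not_le h𝔣).mpr fun w hw hle => ?_
    rw [Ideal.span_singleton_le_iff_mem] at hle
    by_cases hwv₀ : w = v₀
    · exact hk₀v₀ (hwv₀ ▸ hle)
    · exact (hprime𝔣 w hw hwv₀).2 hle
  -- the idelic glue applied to `k = d α`
  set k : Kˣ := Units.mk0 (k₀ : K) (RingOfIntegers.coe_ne_zero_iff.mpr hk₀0) with hkdef
  have hkval : (k : K) = (k₀ : K) := rfl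
  have hglue : rayIdeleValue hψ (principalIdele K k) = 1 := by
    refine rayIdeleValue_principalIdele_eq_one_of_isUnramifiedAt h𝔣 hψ hunr ?_ ?_ ?_
    · -- `k` is a `v₀`-unit
      rw [hkval, show ((k₀ : 𝓞 K) : K) = algebraMap (𝓞 K) K k₀ from rfl, valuation_of_algebraMap]
      exact le_antisymm (intValuation_le_one v₀ k₀)
        (not_lt.mp fun hlt => hk₀v₀ ((intValuation_lt_one_iff_mem v₀ k₀).mp hlt))
    · -- `k ≡ 1 mod 𝔭_w^{n_w}` at the other primes of `(m)`
      intro w hw hwv₀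
      have hw' : Ideal.span {((m : ℕ) : 𝓞 K)} ≤ w.asIdeal := (modulusExp_ne_zero_iff _ h𝔣 w).mp hw
      obtain ⟨hm'w, -⟩ := hprime𝔣 w hw' hwv₀
      obtain ⟨c₀, hc₀⟩ := Ideal.mem_span_singleton'.mp hk₀1
      have hm'K : ((m' : ℕ) : 𝓞 K) ≠ 0 := by exact_mod_cast hm'0
      have e1 : (k : K) - 1 = ((c₀ : 𝓞 K) : K) * (((m' : ℕ) : 𝓞 K) : K) := by
        rw [hkval, ← map_mul (algebraMap (𝓞 K) K), hc₀, map_sub, map_one]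
      rw [e1, map_mul]
      calc w.valuation K ((c₀ : 𝓞 K) : K) * w.valuation K ((((m' : ℕ) : 𝓞 K)) : K)
          ≤ 1 * w.valuation K ((((m' : ℕ) : 𝓞 K)) : K) :=
            mul_le_mul' (valuation_le_one w c₀) le_rfl
        _ = WithZero.exp (-(modulusExp (Ideal.span {((m : ℕ) : 𝓞 K)}) w : ℤ)) := by
            rw [one_mul, valuation_coe_eq_exp_neg_count w hm'K]
            congr 2
            -- `ν_w((m)) = ν_w((m'))` since `ℓ ∉ 𝔭_w`
            have hℓw : ((ℓ : ℕ) : 𝓞 K) ∉ w.asIdeal := fun h => hwv₀ ((hv₀ w).mp h)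
            have hℓ0 : Ideal.span {((ℓ : ℕ) : 𝓞 K)} ≠ ⊥ := by
              rw [Ne, Ideal.span_singleton_eq_bot]; exact_mod_cast hℓ.ne_zero
            have hm'0' : Ideal.span {((m' : ℕ) : 𝓞 K)} ≠ ⊥ := by
              rw [Ne, Ideal.span_singleton_eq_bot]; exact hm'K
            have hcountℓ : (Associates.mk w.asIdeal).count
                (Associates.mk (Ideal.span {((ℓ : ℕ) : 𝓞 K)})).factors = 0 := by
              by_contra hne
              have hdvd := (Associates.count_ne_zero_iff_dvd hℓ0 w.irreducible).mp hne
              exact hℓw ((Ideal.span_singleton_le_iff_mem _).mp (Ideal.le_of_dvd hdvd))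
            unfold modulusExp
            rw [hcast, ← Ideal.span_singleton_mul_span_singleton, ← Associates.mk_mul_mk,
              Associates.count_mul (Associates.mk_ne_zero.mpr hℓ0) (Associates.mk_ne_zero.mpr hm'0')
                ((Associates.irreducible_mk).mpr w.irreducible), hcountℓ, zero_add]
    · -- no real places
      intro w hw
      exact absurd hw (InfinitePlace.not_isReal_iff_isComplex.mpr (hK.2.isComplex w))
  -- read the glue through the ideal character: `ω₀((k)) = χ([(d)]) χ([𝔭_v]) = χ([𝔭_v])`
  have hval := coe_rayIdeleValue_principalIdele_eq_idealPow h𝔣 hψ hk₀0 hcop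
  rw [← hkdef, hglue, Units.val_one] at hval
  have hspan : Ideal.span {k₀} = Ideal.span {((d : ℤ) : 𝓞 K)} * v.asIdeal := by
    rw [hvα, Ideal.span_singleton_mul_span_singleton]
  have hd' : (Ideal.span {((d : ℤ) : 𝓞 K)} : Ideal (𝓞 K)) ≠ ⊥ := by
    rw [Ne, Ideal.span_singleton_eq_bot]; exact hdK0
  have hdcop' : Ideal.span {((d : ℤ) : 𝓞 K)} ⊔ Ideal.span {((m : ℕ) : 𝓞 K)} = ⊤ := by
    rw [← Ideal.isCoprime_iff_sup_eq, Ideal.isCoprime_span_singleton_iff]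
    obtain ⟨a₁, a₂, h12⟩ := hdm
    refine ⟨(a₁ : 𝓞 K), (a₂ : 𝓞 K), ?_⟩
    have := congrArg (fun z : ℤ => (z : 𝓞 K)) h12
    push_cast at this
    exact this
  have e : (fun w => (χ (primeClass m w) : ℂ)) = fun w => ((Units.coeHom ℂ).comp χ) (primeClass m w) := rfl
  rw [e, idealPow_comp_eq ((Units.coeHom ℂ).comp χ) (primeClass m)
      (by rw [Ne, Ideal.span_singleton_eq_bot]; exact hk₀0), hspan,
    artinSymbol_mul (primeClass m) hd' v.ne_bot, artinSymbol_asIdeal,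
    artinSymbol_primeClass_eq_idealClass m hd' hdcop',
    idealClass_span_eq_one m hdK0 (a := d) hdm (by simp) hdcop', MonoidHom.comp_apply,
    Units.coeHom_apply] at hval
  have h2 : χ (1 * primeClass m v) = 1 := Units.val_eq_one.mp hval.symm
  simpa using h2

end Summit.BirchSwinnertonDyer.Rank1Residual.X11b.RingClassTower

end
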